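import Mathlib
import HarnessLib
import Literature.Probability.FitznerVanDerHofstad2017.NobleRelationSummed
import Summits.NavierStokesRegularity.NavierStokesRegularity.Theorems.StretchingWellBindingEnstrophyQuarterLawSparsenessTools

/-!
# Shelf 1574, line `sparse_sieve`: space–time bounded overlap and the level arithmetic for the
# counting half of `EnstrophyQuarterLaw ⇒ UniformSparseness`

Helper file (`--supports stmt-NavierStokesRegularity-1574 --as helper`), companion of
`…EnstrophyQuarterLawSparsenessTools` and consumed by `…EnstrophyQuarterLawSparseness`:

* `sum_setLIntegral_prod_ball_le_of_separated` — for an `s`-separated finite family `F ⊆ ℝ³`, a measurable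
  set of times `A` and any `f ≥ 0`: `Σ_{x ∈ F} ∫∫_{A × B(x, ρ)} f ≤ ((ρ + s/2)/(s/2))³ ∫∫_{A × ℝ³} f`;
* `exists_level` — for `ν > 0`, `V ≥ 0`, `ε₀ > 0` a level `l > 0` with `8 ν³ l³ V < ε₀³` (the sup level at
  which a ball `B(x, 2r)` with `|u| ≤ ν l / r` carries `L³`-mass `< ε₀³`).

HONEST FRAMING: bookkeeping only; nothing here bears on the regularity problem; `EnstrophyQuarterLaw` (1574)
and `UniformSparseness` stay OPEN. No summit statement is proved.
-/

noncomputable section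

-- the summit-side namespace repeats a component by design (D-0017)
set_option linter.dupNamespace false

namespace Summit.NavierStokesRegularity.NavierStokesRegularity.Theorems.EnstrophyQuarterLaw.SparsenessOverlap

open Set MeasureTheory Function Metric Filter Topology
open scoped ENNReal NNReal

/-! ### Bounded overlap in space–time -/

open Classical in
/-- **Bounded overlap in space–time.** For a `s`-separated finite family `F ⊆ ℝ³`, `ρ > 0`, a measurable set
of times `A` and any `f ≥ 0`: `Σ_{x ∈ F} ∫∫_{A × B(x, ρ)} f ≤ ((ρ + s/2)/(s/2))³ ∫∫_{A × ℝ³} f` (pointwise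
count of the balls containing a point, `SparsenessTools.card_filter_mem_ball_le_of_separated`). [folklore] -/
theorem sum_setLIntegral_prod_ball_le_of_separated {s ρ : ℝ} (hs : 0 < s) (hρ : 0 < ρ)
    (F : Finset (EuclideanSpace ℝ (Fin 3))) (hsep : ∀ x ∈ F, ∀ y ∈ F, x ≠ y → s ≤ dist x y)
    {A : Set ℝ} (hA : MeasurableSet A) (f : ℝ × EuclideanSpace ℝ (Fin 3) → ℝ≥0∞) :
    ∑ x ∈ F, ∫⁻ w in A ×ˢ ball x ρ, f w ≤
      ENNReal.ofReal (((ρ + s / 2) / (s / 2)) ^ 3) * ∫⁻ w in A ×ˢ (univ : Set (EuclideanSpace ℝ (Fin 3))), f w := by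
  classical
  set M : ℝ := ((ρ + s / 2) / (s / 2)) ^ 3 with hM
  have hind : ∀ x ∈ F, ∫⁻ w in A ×ˢ ball x ρ, f w = ∫⁻ w, (A ×ˢ ball x ρ).indicator f w := fun x _ =>
    (lintegral_indicator (hA.prod measurableSet_ball) _).symm
  rw [Finset.sum_congr rfl hind, ← lintegral_indicator (hA.prod MeasurableSet.univ) _,
    ← lintegral_const_mul' _ _ ENNReal.ofReal_ne_top]
  refine (Literature.Probability.FitznerVanDerHofstad2017.sum_lintegral_le_lintegral_sum _ _ _).trans
    (lintegral_mono fun w => ?_)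
  by_cases hw : w.1 ∈ A
  · have hpt : ∑ x ∈ F, (A ×ˢ ball x ρ).indicator f w =
        ((F.filter (fun x => w.2 ∈ ball x ρ)).card : ℝ≥0∞) * f w := by
      have h1 : ∀ x ∈ F, (A ×ˢ ball x ρ).indicator f w = if w.2 ∈ ball x ρ then f w else 0 := by
        intro x _
        simp only [Set.indicator_apply, mem_prod, hw, true_and]
      rw [Finset.sum_congr rfl h1, ← Finset.sum_filter, Finset.sum_const, nsmul_eq_mul]
    have hR : (A ×ˢ (univ : Set (EuclideanSpace ℝ (Fin 3)))).indicator f w = f w := by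
      simp only [Set.indicator_apply, mem_prod, hw, mem_univ, and_self, if_true]
    rw [hpt, hR]
    refine mul_le_mul' ?_ le_rfl
    have hc := SparsenessTools.card_filter_mem_ball_le_of_separated hs hρ F hsep w.2
    calc ((F.filter (fun x => w.2 ∈ ball x ρ)).card : ℝ≥0∞)
        = ENNReal.ofReal ((F.filter (fun x => w.2 ∈ ball x ρ)).card : ℝ) := by
          rw [ENNReal.ofReal_natCast]
      _ ≤ ENNReal.ofReal M := ENNReal.ofReal_le_ofReal hc
  · have h0 : ∑ x ∈ F, (A ×ˢ ball x ρ).indicator f w = 0 := by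
      refine Finset.sum_eq_zero fun x _ => ?_
      simp only [Set.indicator_apply, mem_prod, hw, false_and, if_false]
    rw [h0]
    exact zero_le

/-! ### The sup level -/

/-- For `ν > 0`, `V ≥ 0`, `ε₀ > 0` there is `l > 0` with `8 ν³ l³ V < ε₀³`
(`l = ε₀ · min(1, 1/(ν(8V + 2)))`). [folklore] -/
theorem exists_level {ν V ε₀ : ℝ} (hν : 0 < ν) (hV0 : 0 ≤ V) (hε₀ : 0 < ε₀) :
    ∃ l : ℝ, 0 < l ∧ 8 * ν ^ 3 * l ^ 3 * V < ε₀ ^ 3 := by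
  set m₁ : ℝ := min 1 (1 / (ν * (8 * V + 2))) with hm₁
  have hm₁pos : 0 < m₁ := lt_min one_pos (by positivity)
  refine ⟨ε₀ * m₁, mul_pos hε₀ hm₁pos, ?_⟩
  have hνm : ν * m₁ ≤ 1 / (8 * V + 2) := by
    have h1 : ν * m₁ ≤ ν * (1 / (ν * (8 * V + 2))) := mul_le_mul_of_nonneg_left (min_le_right _ _) hν.le
    refine h1.trans (le_of_eq ?_)
    field_simp
  have hνm0 : 0 ≤ ν * m₁ := by positivity
  have hνm1 : ν * m₁ ≤ 1 := hνm.trans (by rw [div_le_one (by positivity)]; linarith)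
  have hcube : (ν * m₁) ^ 3 ≤ ν * m₁ := by
    calc (ν * m₁) ^ 3 = (ν * m₁) * ((ν * m₁) * (ν * m₁)) := by ring
      _ ≤ (ν * m₁) * (1 * 1) := by
          refine mul_le_mul_of_nonneg_left ?_ hνm0
          exact mul_le_mul hνm1 hνm1 hνm0 zero_le_one
      _ = ν * m₁ := by ring
  have h8 : 8 * V * (ν * m₁) ^ 3 < 1 := by
    calc 8 * V * (ν * m₁) ^ 3 ≤ 8 * V * (ν * m₁) := mul_le_mul_of_nonneg_left hcube (by positivity)
      _ ≤ 8 * V * (1 / (8 * V + 2)) := mul_le_mul_of_nonneg_left hνm (by positivity)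
      _ < 1 := by rw [← mul_div_assoc, mul_one, div_lt_one (by positivity)]; linarith
  have e : 8 * ν ^ 3 * (ε₀ * m₁) ^ 3 * V = ε₀ ^ 3 * (8 * V * (ν * m₁) ^ 3) := by ring
  rw [e]
  calc ε₀ ^ 3 * (8 * V * (ν * m₁) ^ 3) < ε₀ ^ 3 * 1 := mul_lt_mul_of_pos_left h8 (pow_pos hε₀ 3)
    _ = ε₀ ^ 3 := mul_one _

end Summit.NavierStokesRegularity.NavierStokesRegularity.Theorems.EnstrophyQuarterLaw.SparsenessOverlap

end
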